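import Summits.QuantumFields.YangMills.Theorems.UnitScaleTiltMinimiserStabilityRegPrOfB8Thm2AtT3Members
import Summits.QuantumFields.YangMills.Theorems.UnitScaleTiltThm1GuardedFiveResidueThree
import Summits.QuantumFields.YangMills.Theorems.AlphaInputsT3ACv4RecordSelXs
import Summits.QuantumFields.YangMills.Theorems.CoarseStiffnessTailCappedCoarseStiffnessLUnitPolyTailOfChi
import Summits.QuantumFields.YangMills.Theses.CoarseStiffnessTail
import HarnessLib

/-!
# Route `CoarseStiffnessTail` — ITS DECIDING CRUX `UnitPolyTailL` (stmt-QuantumFields-24027) BY NAME FROM 19936's TWO REGISTERED ROWS,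
# and from {ONE NAMED LITERATURE FACT, the NODE-O row}: `UnitPolyTailL ⟸ {⟨stub_existenceMinimalOrbit⟩, ⟨stub_selXsV4DataRows⟩}`,
# `UnitPolyTailL ⟸ {B8Thm2AtT3Members, ⟨stub_selXsV4DataRows⟩}`, `UnitPolyTailL ⟸ {EX at L = 3, ⟨stub_selXsV4DataRows⟩}`, `UnitPolyTailL ⟸ {T8, ⟨stub_selXsV4DataRows⟩}`

Cell `ym3-torus` ∕ HOME `pub/ideators/ym-r3-idea-2` (YM ladder rung R3 = continuum `SU(2)` Yang–Mills on T³ — a RUNG, NOT d = 4, NOT infinite volume, NOT a mass gap, NOT Clay);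
seat `ym-line-cst-p1` g40 (the route's own line seat; base items stmt-QuantumFields-25301∕25302); `--supports stmt-QuantumFields-24027 --as helper`, count-neutral,
definition-free, default heartbeats; route ∕ registry ∕ `closes` untouched (J-FREEZE honoured).

WHY.  The route's deciding crux S1_poly = `CoarseStiffnessTail.UnitPolyTailL` (24027; the unit-scale single-plaquette POWER tail of the fully block-averaged field,
K-uniform — STRONGER than `HistoryTailL` (19936): ✓`historyTailL_of_unitPolyTail`, item 24029) had, until now, two kinds of kernel suppliers: rev 0's crux
`CappedCoarseStiffnessL` (25301, XL, open) and the χ-LANE socket of 19936's RETIRED line v5p10 (✓p693189 `unitPolyTailL_of_laneRecordsV4Chi` ∕ `…_of_intCoreRecRows`,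
this seat g24).  Since then crux 19936's registry moved to `Lines/unbundled_v6.lean` = {`stub_existenceMinimalOrbit` (EX, shared with 19200's v10), `stub_selXsV4DataRows`
(NODE O's Sel∕Xs v4 χ-data rows)}, and the tree grew the doors EX ⟹ T8 (✓`thm1In8_allL_of_existenceMinimalOrbit`, halving leaf landed), {T8, rows} ⟹ v4 χ-record
(✓`laneRecordsV4Chi_of_thm1In8_selXsDataRows_allL`), `B8Thm2AtT3Members ⟹ EX` (✓`exStub_of_b8Thm2AtT3Members`, ★p1 g30) and EX ⟸ EX@3 (✓`exBody_allL_of_three`, this seat g39).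
THIS FILE composes them AT THE ROUTE DECL: the deciding crux of route `CoarseStiffnessTail` needs NOTHING beyond 19936's two registered rows — the SAME two rows give the
stronger unit POLY tail, not only the history tail — and, through the named fact, reads {`B8Thm2AtT3Members`, ⟨stub_selXsV4DataRows⟩}; at `L ≥ 5` EX is a theorem, so the
EX input is its `L = 3` instance alone.

WHAT (all BY NAME; hypotheses are the registered TEXTS VERBATIM — `hEX` = `unbundled_v6.lean` `stub_existenceMinimalOrbit`, `hrows` = `stub_selXsV4DataRows`, `hEX₃` = EX's `L = 3` instance
as displayed by ✓`exBody_allL_of_three`, `hT8` = [Balaban1985Variational] Thm 1 ∧ (8) at every odd `L > 1`):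
§1 `laneRecordsV4Chi_of_existenceMinimalOrbit_selXsV4DataRows` — the v4 χ-record at every odd `L > 1` from 19936's two rows ({T8, rows} is ✓`laneRecordsV4Chi_of_thm1In8_selXsDataRows_allL` itself);
§2 ★★★`unitPolyTailL_of_T8_selXsV4DataRows`, ★★★`unitPolyTailL_of_existenceMinimalOrbit_selXsV4DataRows` (24027 ⟸ 19936's two rows), ★★★`unitPolyTailL_of_b8Thm2AtT3Members_selXsV4DataRows`
(24027 ⟸ {named fact, NODE-O row}), ★★`unitPolyTailL_of_existenceAtThree_selXsV4DataRows` (EX at `L = 3` only), `unitPolyTailL_of_thm1In8AtThree_selXsV4DataRows` (T8 at `L = 3` only).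
(The rung leaf from the same inputs is ALREADY ✓p794677∕✓p795538 — not restated here.)

HONEST SCOPE (CREDIT NOTHING): compositions of landed theorems; every hypothesis — EX (19200∕19936 row, = [Balaban1985Variational] Prop. 7's existence clause), the NODE-O rows
([Balaban1985UV3] (67)–(71)), `B8Thm2AtT3Members` ([Balaban1985RegularSpaces] Thm 2 at the members, OPEN exactly at `L = 3`), T8 — is an OPEN statement; `UnitPolyTailL` (24027),
`CappedCoarseStiffnessL` (25301), `HistoryTailL` (19936), `YM3TorusSU2` are NOT proved; embargo-lite №58 untouched; rung R3 = SU(2) YM₃ on T³ — NOT d = 4, NOT infinite volume,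
NOT a mass gap, NOT Clay; the Yang–Mills mass gap is NOT proved.  Sorry-free, axioms standard.

References: T. Bałaban, CMP **102** (1985) 255–275 [Balaban1985UV3] ((5) p.256, (47) p.267, (67)–(71) p.273); ibid. 277–309 [Balaban1985Variational] (Thm 1 (8) p.279, Prop. 7
p.299, Prop. 8 p.304); CMP **99** (1985) 75–102 [Balaban1985RegularSpaces] (Thm 2 p.83); C. King, CMP **103** (1986) 323–349 [King1986].
-/

set_option autoImplicit false

noncomputable section

namespace Summit.QuantumFields.YangMills.Theorems.CoarseStiffnessTailUnitPolyTailLOfSelXsV4DataRows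

open MeasureTheory
open scoped Matrix.Norms.L2Operator
open Literature.MathematicalPhysics.QuantumFieldTheory.Balaban1983to89
open Literature.MathematicalPhysics.QuantumFieldTheory.Balaban1983to89.T3ContinuumYM3Torus
open Literature.MathematicalPhysics.QuantumFieldTheory.Balaban1983to89.T3UnitLawDensityEML (ℰp)
open Literature.MathematicalPhysics.QuantumFieldTheory.Balaban1983to89.T3UnitScaleTilt
open Literature.MathematicalPhysics.QuantumFieldTheory.Balaban1983to89.T3PrintedRegularMinimiser
open Literature.MathematicalPhysics.QuantumFieldTheory.Balaban1983to89.T3PrintedMinimiserExistence (Thm1GlobalMinAt)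
open Literature.MathematicalPhysics.QuantumFieldTheory.Balaban1983to89.T3LowerAlongMinimisersSplit (MinimisersIn8At)
open Literature.MathematicalPhysics.QuantumFieldTheory.Balaban1983to89.T3ConstrainedMinimiser (fibre)
open Literature.MathematicalPhysics.QuantumFieldTheory.Balaban1983to89.ExpMeanLog (deltaSU)
open Literature.MathematicalPhysics.QuantumFieldTheory.Balaban1983to89.T3B8Thm2AtMembers (B8Thm2AtT3Members)
open Literature.MathematicalPhysics.QuantumFieldTheory.Balaban1985CMP102
open Literature.MathematicalPhysics.QuantumFieldTheory.Balaban1985CMP102.Setting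
open Summit.QuantumFields.Balaban3D.Carriers (suGroupModel)
open Summit.QuantumFields.Balaban3D.Proofs.Primitives (AlphaConsts)
open Summit.QuantumFields.Balaban3D.Proofs.Thresholds (Q0)
open B7Prop2Explicit (C0)
open Summit.QuantumFields.YangMills.Theses.CoarseStiffnessTail (UnitPolyTailL)
open Summit.QuantumFields.YangMills.Theorems
open Summit.QuantumFields.YangMills.Theorems.MinimiserStabilityRegPrOfB8Thm2AtT3Members (exStub_of_b8Thm2AtT3Members)
open Summit.QuantumFields.YangMills.Theorems.HistoryTailOfExistenceMinimalOrbit (thm1In8_allL_of_existenceMinimalOrbit)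
open Summit.QuantumFields.YangMills.Theorems.Thm1GuardedFiveResidueThree (exBody_allL_of_three thm1In8_allL_of_three)
open Summit.QuantumFields.YangMills.Theorems.HistoryTailSelSupplier (laneRecordsV4Chi_of_thm1In8_selXsDataRows_allL)
open Summit.QuantumFields.YangMills.Theorems.CoarseStiffnessTailUnitPolyTailOfChi (unitPolyTail_of_laneRecordsV4Chi)

/-! ## §1 The v4 χ-record at every odd `L > 1` from {T8 or EX, the NODE-O rows} -/

/-- **THE v4 χ-RECORD FROM 19936's TWO REGISTERED ROWS {⟨stub_existenceMinimalOrbit⟩, ⟨stub_selXsV4DataRows⟩}** (EX ⟹ T8 by ✓`thm1In8_allL_of_existenceMinimalOrbit`, halving leaf landed).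
[cite: Balaban1985UV3, (47) p.267 and (67)–(71) p.273; Balaban1985Variational, Prop. 7 p.299 and Prop. 8 p.304] -/
theorem laneRecordsV4Chi_of_existenceMinimalOrbit_selXsV4DataRows
        (hEX : ∀ (L : ℕ), 1 < L → ∀ (B₃ : ℝ), 4 < B₃ → ∃ a₁' O₁ : ℝ, 0 < a₁' ∧ 1 ≤ O₁ ∧
      ∀ (F : T3Family), F.L = L → ∀ (n K : ℕ) (hnK : n < K) (ε₁ : ℝ), 0 < ε₁ →
        ∀ V : GaugeField (F.P n) 0 (Matrix.specialUnitaryGroup (Fin 2) ℂ), PlaqSmall ε₁ V →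
          ∀ U₀ : GaugeField (F.P K) 0 (Matrix.specialUnitaryGroup (Fin 2) ℂ), RegPr F n K ((L : ℝ) ^ 3 * B₃ * ε₁) U₀ → U₀ ∈ fibre F ℰp n K hnK.le V →
            ε₁ ≤ a₁' → ∃ U ∈ regFibrePr F n K hnK.le (O₁ * (L : ℝ) ^ 3 * B₃ * ε₁) V,
              IsMinOn (fun W : GaugeField (F.P K) 0 (Matrix.specialUnitaryGroup (Fin 2) ℂ) => wilsonAction4 W)
                (regFibrePr F n K hnK.le (O₁ * (L : ℝ) ^ 3 * B₃ * ε₁) V) U)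
        (hrows : ∀ L : ℕ, Odd L → 1 < L → ∃ (B₀ A₀ A₁ : ℝ), 0 < A₀ ∧ 0 < A₁ ∧
      ∀ (B a₀ a₁ : ℝ), B₀ ≤ B → 1 ≤ 2 * B → 0 < a₀ → a₀ ≤ A₀ → 0 < a₁ → a₁ ≤ A₁ → B * a₁ ≤ a₀ →
        (143 * ((((3 + 4 : ℕ) : ℝ)) ^ 2 / 4) ^ 2) * (2 * (B * a₁)) ≤ 1 / 3 →
        2 * (2 * (B * a₁)) ≤ 2 * deltaSU (Fin 2) / (((3 + 4) * L : ℕ) : ℝ) ^ 2 →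
        Thm1GlobalMinAt L a₀ a₁ B →
        ∃ (b₁ p₁ : ℝ), ∀ (b₀ p₀ : ℝ), b₁ ≤ b₀ → p₁ ≤ p₀ →
          ∃ 𝔠 : AlphaConsts L (suGroupModel 2).N, 𝔠.b₀ = b₀ ∧ 𝔠.p₀ = p₀ ∧ 𝔠.B₃ = B ∧
            4 * 𝔠.B₃ * (L : ℝ) ^ 2 * avgWindowFactor L ≤ 𝔠.C68 ∧
            Real.exp (𝔠.p₀ - 1) ≤ 3 * C0 3 * 𝔠.C68 * (𝔠.b₀ * Q0 𝔠.p₀) ∧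
            (𝔠.b₀ * Q0 𝔠.p₀) * (2 * (L : ℝ) ^ 2 * avgWindowFactor L) ^ 2 ≤ 3 * C0 3 * 𝔠.C68 * a₁ ^ 2 ∧
            ∀ (F : T3Family) (hF : F.L = L),
              (∀ (γ : ℝ) (hγ : 0 < γ) (hγ1 : γ ≤ (min (hF ▸ 𝔠).gamma0 1) ^ 2) (K : ℕ),
                AlphaInputsT3AC.SmallFactor71OfRecT3 F (hF ▸ 𝔠) γ hγ hγ1 K) ∧
              ∀ (γ : ℝ) (hγ : 0 < γ) (hγ1 : γ ≤ (min (hF ▸ 𝔠).gamma0 1) ^ 2) (K : ℕ),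
                (∃ Ut : (k : ℕ) → GaugeField (F.P K) k (Matrix.specialUnitaryGroup (Fin 2) ℂ) →
                    GaugeField (F.P K) 0 (Matrix.specialUnitaryGroup (Fin 2) ℂ),
                  AlphaInputsT3AC.TrivMinimiserRowsT3 F (hF ▸ 𝔠) γ hγ hγ1 a₀ a₁ K Ut) →
                ∃ Ut : (k : ℕ) → GaugeField (F.P K) k (Matrix.specialUnitaryGroup (Fin 2) ℂ) →
                    GaugeField (F.P K) 0 (Matrix.specialUnitaryGroup (Fin 2) ℂ),
                  AlphaInputsT3AC.TrivMinimiserRowsT3 F (hF ▸ 𝔠) γ hγ hγ1 a₀ a₁ K Ut ∧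
                    AlphaInputsT3AC.DataRowsT3XsChiSel F (hF ▸ 𝔠) γ hγ hγ1 K Ut) :
    ∀ L : ℕ, Odd L → 1 < L → AlphaInputsT3ACv4RecChi L :=
  laneRecordsV4Chi_of_thm1In8_selXsDataRows_allL (thm1In8_allL_of_existenceMinimalOrbit hEX) hrows

/-! ## §2 The route's deciding crux `UnitPolyTailL` (stmt-QuantumFields-24027) BY NAME -/

/-- ★★★ **`UnitPolyTailL` ⟸ {T8, ⟨stub_selXsV4DataRows⟩}** (✓`laneRecordsV4Chi_of_thm1In8_selXsDataRows_allL` ∘ ✓`unitPolyTail_of_laneRecordsV4Chi`, matched against the route decl by `unfold`).  CONDITIONAL on both inputs.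
[cite: Balaban1985UV3, (5) p.256, (47) p.267 and (67)–(71) p.273; Balaban1985Variational, Thm 1 (8) p.279] -/
theorem unitPolyTailL_of_T8_selXsV4DataRows
    (hT8 : ∀ L : ℕ, Odd L → 1 < L → ∃ a₀ a₁ B₃ : ℝ, 0 < a₀ ∧ 0 < a₁ ∧ 0 < B₃ ∧
      Thm1GlobalMinAt L a₀ a₁ B₃ ∧ MinimisersIn8At L a₀ a₁ B₃)
        (hrows : ∀ L : ℕ, Odd L → 1 < L → ∃ (B₀ A₀ A₁ : ℝ), 0 < A₀ ∧ 0 < A₁ ∧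
      ∀ (B a₀ a₁ : ℝ), B₀ ≤ B → 1 ≤ 2 * B → 0 < a₀ → a₀ ≤ A₀ → 0 < a₁ → a₁ ≤ A₁ → B * a₁ ≤ a₀ →
        (143 * ((((3 + 4 : ℕ) : ℝ)) ^ 2 / 4) ^ 2) * (2 * (B * a₁)) ≤ 1 / 3 →
        2 * (2 * (B * a₁)) ≤ 2 * deltaSU (Fin 2) / (((3 + 4) * L : ℕ) : ℝ) ^ 2 →
        Thm1GlobalMinAt L a₀ a₁ B →
        ∃ (b₁ p₁ : ℝ), ∀ (b₀ p₀ : ℝ), b₁ ≤ b₀ → p₁ ≤ p₀ →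
          ∃ 𝔠 : AlphaConsts L (suGroupModel 2).N, 𝔠.b₀ = b₀ ∧ 𝔠.p₀ = p₀ ∧ 𝔠.B₃ = B ∧
            4 * 𝔠.B₃ * (L : ℝ) ^ 2 * avgWindowFactor L ≤ 𝔠.C68 ∧
            Real.exp (𝔠.p₀ - 1) ≤ 3 * C0 3 * 𝔠.C68 * (𝔠.b₀ * Q0 𝔠.p₀) ∧
            (𝔠.b₀ * Q0 𝔠.p₀) * (2 * (L : ℝ) ^ 2 * avgWindowFactor L) ^ 2 ≤ 3 * C0 3 * 𝔠.C68 * a₁ ^ 2 ∧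
            ∀ (F : T3Family) (hF : F.L = L),
              (∀ (γ : ℝ) (hγ : 0 < γ) (hγ1 : γ ≤ (min (hF ▸ 𝔠).gamma0 1) ^ 2) (K : ℕ),
                AlphaInputsT3AC.SmallFactor71OfRecT3 F (hF ▸ 𝔠) γ hγ hγ1 K) ∧
              ∀ (γ : ℝ) (hγ : 0 < γ) (hγ1 : γ ≤ (min (hF ▸ 𝔠).gamma0 1) ^ 2) (K : ℕ),
                (∃ Ut : (k : ℕ) → GaugeField (F.P K) k (Matrix.specialUnitaryGroup (Fin 2) ℂ) →
                    GaugeField (F.P K) 0 (Matrix.specialUnitaryGroup (Fin 2) ℂ),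
                  AlphaInputsT3AC.TrivMinimiserRowsT3 F (hF ▸ 𝔠) γ hγ hγ1 a₀ a₁ K Ut) →
                ∃ Ut : (k : ℕ) → GaugeField (F.P K) k (Matrix.specialUnitaryGroup (Fin 2) ℂ) →
                    GaugeField (F.P K) 0 (Matrix.specialUnitaryGroup (Fin 2) ℂ),
                  AlphaInputsT3AC.TrivMinimiserRowsT3 F (hF ▸ 𝔠) γ hγ hγ1 a₀ a₁ K Ut ∧
                    AlphaInputsT3AC.DataRowsT3XsChiSel F (hF ▸ 𝔠) γ hγ hγ1 K Ut) :
    UnitPolyTailL := by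
  unfold UnitPolyTailL
  exact unitPolyTail_of_laneRecordsV4Chi (laneRecordsV4Chi_of_thm1In8_selXsDataRows_allL hT8 hrows)

/-- ★★★ **THE DECIDING CRUX OF ROUTE `CoarseStiffnessTail` FROM 19936's TWO REGISTERED ROWS, BY NAME**: `UnitPolyTailL ⟸ {⟨stub_existenceMinimalOrbit⟩, ⟨stub_selXsV4DataRows⟩}` —
the SAME two rows that give `HistoryTailL` (✓`historyTailL_of_existenceMinimalOrbit_selXsV4DataRows_allL`) give the STRONGER unit-scale power tail.  CONDITIONAL on both rows.
[cite: Balaban1985UV3, (5) p.256, (47) p.267 and (67)–(71) p.273; Balaban1985Variational, Prop. 7 p.299 and Prop. 8 p.304] -/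
theorem unitPolyTailL_of_existenceMinimalOrbit_selXsV4DataRows
        (hEX : ∀ (L : ℕ), 1 < L → ∀ (B₃ : ℝ), 4 < B₃ → ∃ a₁' O₁ : ℝ, 0 < a₁' ∧ 1 ≤ O₁ ∧
      ∀ (F : T3Family), F.L = L → ∀ (n K : ℕ) (hnK : n < K) (ε₁ : ℝ), 0 < ε₁ →
        ∀ V : GaugeField (F.P n) 0 (Matrix.specialUnitaryGroup (Fin 2) ℂ), PlaqSmall ε₁ V →
          ∀ U₀ : GaugeField (F.P K) 0 (Matrix.specialUnitaryGroup (Fin 2) ℂ), RegPr F n K ((L : ℝ) ^ 3 * B₃ * ε₁) U₀ → U₀ ∈ fibre F ℰp n K hnK.le V →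
            ε₁ ≤ a₁' → ∃ U ∈ regFibrePr F n K hnK.le (O₁ * (L : ℝ) ^ 3 * B₃ * ε₁) V,
              IsMinOn (fun W : GaugeField (F.P K) 0 (Matrix.specialUnitaryGroup (Fin 2) ℂ) => wilsonAction4 W)
                (regFibrePr F n K hnK.le (O₁ * (L : ℝ) ^ 3 * B₃ * ε₁) V) U)
        (hrows : ∀ L : ℕ, Odd L → 1 < L → ∃ (B₀ A₀ A₁ : ℝ), 0 < A₀ ∧ 0 < A₁ ∧
      ∀ (B a₀ a₁ : ℝ), B₀ ≤ B → 1 ≤ 2 * B → 0 < a₀ → a₀ ≤ A₀ → 0 < a₁ → a₁ ≤ A₁ → B * a₁ ≤ a₀ →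
        (143 * ((((3 + 4 : ℕ) : ℝ)) ^ 2 / 4) ^ 2) * (2 * (B * a₁)) ≤ 1 / 3 →
        2 * (2 * (B * a₁)) ≤ 2 * deltaSU (Fin 2) / (((3 + 4) * L : ℕ) : ℝ) ^ 2 →
        Thm1GlobalMinAt L a₀ a₁ B →
        ∃ (b₁ p₁ : ℝ), ∀ (b₀ p₀ : ℝ), b₁ ≤ b₀ → p₁ ≤ p₀ →
          ∃ 𝔠 : AlphaConsts L (suGroupModel 2).N, 𝔠.b₀ = b₀ ∧ 𝔠.p₀ = p₀ ∧ 𝔠.B₃ = B ∧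
            4 * 𝔠.B₃ * (L : ℝ) ^ 2 * avgWindowFactor L ≤ 𝔠.C68 ∧
            Real.exp (𝔠.p₀ - 1) ≤ 3 * C0 3 * 𝔠.C68 * (𝔠.b₀ * Q0 𝔠.p₀) ∧
            (𝔠.b₀ * Q0 𝔠.p₀) * (2 * (L : ℝ) ^ 2 * avgWindowFactor L) ^ 2 ≤ 3 * C0 3 * 𝔠.C68 * a₁ ^ 2 ∧
            ∀ (F : T3Family) (hF : F.L = L),
              (∀ (γ : ℝ) (hγ : 0 < γ) (hγ1 : γ ≤ (min (hF ▸ 𝔠).gamma0 1) ^ 2) (K : ℕ),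
                AlphaInputsT3AC.SmallFactor71OfRecT3 F (hF ▸ 𝔠) γ hγ hγ1 K) ∧
              ∀ (γ : ℝ) (hγ : 0 < γ) (hγ1 : γ ≤ (min (hF ▸ 𝔠).gamma0 1) ^ 2) (K : ℕ),
                (∃ Ut : (k : ℕ) → GaugeField (F.P K) k (Matrix.specialUnitaryGroup (Fin 2) ℂ) →
                    GaugeField (F.P K) 0 (Matrix.specialUnitaryGroup (Fin 2) ℂ),
                  AlphaInputsT3AC.TrivMinimiserRowsT3 F (hF ▸ 𝔠) γ hγ hγ1 a₀ a₁ K Ut) →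
                ∃ Ut : (k : ℕ) → GaugeField (F.P K) k (Matrix.specialUnitaryGroup (Fin 2) ℂ) →
                    GaugeField (F.P K) 0 (Matrix.specialUnitaryGroup (Fin 2) ℂ),
                  AlphaInputsT3AC.TrivMinimiserRowsT3 F (hF ▸ 𝔠) γ hγ hγ1 a₀ a₁ K Ut ∧
                    AlphaInputsT3AC.DataRowsT3XsChiSel F (hF ▸ 𝔠) γ hγ hγ1 K Ut) :
    UnitPolyTailL :=
  unitPolyTailL_of_T8_selXsV4DataRows (thm1In8_allL_of_existenceMinimalOrbit hEX) hrows

/-- ★★★ **THE DECIDING CRUX OF ROUTE `CoarseStiffnessTail` FROM ONE NAMED LITERATURE FACT AND THE NODE-O ROW**: `UnitPolyTailL ⟸ {B8Thm2AtT3Members, ⟨stub_selXsV4DataRows⟩}`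
(EX := ✓`exStub_of_b8Thm2AtT3Members hX`).  CONDITIONAL on both; the fact is OPEN exactly at `L = 3` (debt item, embargo-lite №58).
[cite: Balaban1985RegularSpaces, Thm 2 p.83; Balaban1985UV3, (5) p.256 and (67)–(71) p.273; Balaban1985Variational, Prop. 7 p.299] -/
theorem unitPolyTailL_of_b8Thm2AtT3Members_selXsV4DataRows (hX : B8Thm2AtT3Members)
        (hrows : ∀ L : ℕ, Odd L → 1 < L → ∃ (B₀ A₀ A₁ : ℝ), 0 < A₀ ∧ 0 < A₁ ∧
      ∀ (B a₀ a₁ : ℝ), B₀ ≤ B → 1 ≤ 2 * B → 0 < a₀ → a₀ ≤ A₀ → 0 < a₁ → a₁ ≤ A₁ → B * a₁ ≤ a₀ →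
        (143 * ((((3 + 4 : ℕ) : ℝ)) ^ 2 / 4) ^ 2) * (2 * (B * a₁)) ≤ 1 / 3 →
        2 * (2 * (B * a₁)) ≤ 2 * deltaSU (Fin 2) / (((3 + 4) * L : ℕ) : ℝ) ^ 2 →
        Thm1GlobalMinAt L a₀ a₁ B →
        ∃ (b₁ p₁ : ℝ), ∀ (b₀ p₀ : ℝ), b₁ ≤ b₀ → p₁ ≤ p₀ →
          ∃ 𝔠 : AlphaConsts L (suGroupModel 2).N, 𝔠.b₀ = b₀ ∧ 𝔠.p₀ = p₀ ∧ 𝔠.B₃ = B ∧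
            4 * 𝔠.B₃ * (L : ℝ) ^ 2 * avgWindowFactor L ≤ 𝔠.C68 ∧
            Real.exp (𝔠.p₀ - 1) ≤ 3 * C0 3 * 𝔠.C68 * (𝔠.b₀ * Q0 𝔠.p₀) ∧
            (𝔠.b₀ * Q0 𝔠.p₀) * (2 * (L : ℝ) ^ 2 * avgWindowFactor L) ^ 2 ≤ 3 * C0 3 * 𝔠.C68 * a₁ ^ 2 ∧
            ∀ (F : T3Family) (hF : F.L = L),
              (∀ (γ : ℝ) (hγ : 0 < γ) (hγ1 : γ ≤ (min (hF ▸ 𝔠).gamma0 1) ^ 2) (K : ℕ),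
                AlphaInputsT3AC.SmallFactor71OfRecT3 F (hF ▸ 𝔠) γ hγ hγ1 K) ∧
              ∀ (γ : ℝ) (hγ : 0 < γ) (hγ1 : γ ≤ (min (hF ▸ 𝔠).gamma0 1) ^ 2) (K : ℕ),
                (∃ Ut : (k : ℕ) → GaugeField (F.P K) k (Matrix.specialUnitaryGroup (Fin 2) ℂ) →
                    GaugeField (F.P K) 0 (Matrix.specialUnitaryGroup (Fin 2) ℂ),
                  AlphaInputsT3AC.TrivMinimiserRowsT3 F (hF ▸ 𝔠) γ hγ hγ1 a₀ a₁ K Ut) →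
                ∃ Ut : (k : ℕ) → GaugeField (F.P K) k (Matrix.specialUnitaryGroup (Fin 2) ℂ) →
                    GaugeField (F.P K) 0 (Matrix.specialUnitaryGroup (Fin 2) ℂ),
                  AlphaInputsT3AC.TrivMinimiserRowsT3 F (hF ▸ 𝔠) γ hγ hγ1 a₀ a₁ K Ut ∧
                    AlphaInputsT3AC.DataRowsT3XsChiSel F (hF ▸ 𝔠) γ hγ hγ1 K Ut) :
    UnitPolyTailL :=
  unitPolyTailL_of_existenceMinimalOrbit_selXsV4DataRows (exStub_of_b8Thm2AtT3Members hX) hrows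

/-- ★★ **`UnitPolyTailL` ⟸ {EX AT `L = 3` ONLY, ⟨stub_selXsV4DataRows⟩}** — EX at every `L ≥ 5` is the theorem ✓`exBody_guarded_five`, even `L` carry no family
(✓`exBody_allL_of_three`).  CONDITIONAL on the `L = 3` residue and the rows. [cite: Balaban1985Variational, Prop. 7 p.299 and (14) p.280; Balaban1985UV3, (67)–(71) p.273] -/
theorem unitPolyTailL_of_existenceAtThree_selXsV4DataRows
        (hEX₃ : ∀ (B₃ : ℝ), 4 < B₃ → ∃ a₁' O₁ : ℝ, 0 < a₁' ∧ 1 ≤ O₁ ∧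
      ∀ (F : T3Family), F.L = 3 → ∀ (n K : ℕ) (hnK : n < K) (ε₁ : ℝ), 0 < ε₁ →
        ∀ V : GaugeField (F.P n) 0 (Matrix.specialUnitaryGroup (Fin 2) ℂ), PlaqSmall ε₁ V →
          ∀ U₀ : GaugeField (F.P K) 0 (Matrix.specialUnitaryGroup (Fin 2) ℂ), RegPr F n K (((3 : ℕ) : ℝ) ^ 3 * B₃ * ε₁) U₀ → U₀ ∈ fibre F ℰp n K hnK.le V →
            ε₁ ≤ a₁' → ∃ U ∈ regFibrePr F n K hnK.le (O₁ * ((3 : ℕ) : ℝ) ^ 3 * B₃ * ε₁) V,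
              IsMinOn (fun W : GaugeField (F.P K) 0 (Matrix.specialUnitaryGroup (Fin 2) ℂ) => wilsonAction4 W)
                (regFibrePr F n K hnK.le (O₁ * ((3 : ℕ) : ℝ) ^ 3 * B₃ * ε₁) V) U)
        (hrows : ∀ L : ℕ, Odd L → 1 < L → ∃ (B₀ A₀ A₁ : ℝ), 0 < A₀ ∧ 0 < A₁ ∧
      ∀ (B a₀ a₁ : ℝ), B₀ ≤ B → 1 ≤ 2 * B → 0 < a₀ → a₀ ≤ A₀ → 0 < a₁ → a₁ ≤ A₁ → B * a₁ ≤ a₀ →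
        (143 * ((((3 + 4 : ℕ) : ℝ)) ^ 2 / 4) ^ 2) * (2 * (B * a₁)) ≤ 1 / 3 →
        2 * (2 * (B * a₁)) ≤ 2 * deltaSU (Fin 2) / (((3 + 4) * L : ℕ) : ℝ) ^ 2 →
        Thm1GlobalMinAt L a₀ a₁ B →
        ∃ (b₁ p₁ : ℝ), ∀ (b₀ p₀ : ℝ), b₁ ≤ b₀ → p₁ ≤ p₀ →
          ∃ 𝔠 : AlphaConsts L (suGroupModel 2).N, 𝔠.b₀ = b₀ ∧ 𝔠.p₀ = p₀ ∧ 𝔠.B₃ = B ∧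
            4 * 𝔠.B₃ * (L : ℝ) ^ 2 * avgWindowFactor L ≤ 𝔠.C68 ∧
            Real.exp (𝔠.p₀ - 1) ≤ 3 * C0 3 * 𝔠.C68 * (𝔠.b₀ * Q0 𝔠.p₀) ∧
            (𝔠.b₀ * Q0 𝔠.p₀) * (2 * (L : ℝ) ^ 2 * avgWindowFactor L) ^ 2 ≤ 3 * C0 3 * 𝔠.C68 * a₁ ^ 2 ∧
            ∀ (F : T3Family) (hF : F.L = L),
              (∀ (γ : ℝ) (hγ : 0 < γ) (hγ1 : γ ≤ (min (hF ▸ 𝔠).gamma0 1) ^ 2) (K : ℕ),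
                AlphaInputsT3AC.SmallFactor71OfRecT3 F (hF ▸ 𝔠) γ hγ hγ1 K) ∧
              ∀ (γ : ℝ) (hγ : 0 < γ) (hγ1 : γ ≤ (min (hF ▸ 𝔠).gamma0 1) ^ 2) (K : ℕ),
                (∃ Ut : (k : ℕ) → GaugeField (F.P K) k (Matrix.specialUnitaryGroup (Fin 2) ℂ) →
                    GaugeField (F.P K) 0 (Matrix.specialUnitaryGroup (Fin 2) ℂ),
                  AlphaInputsT3AC.TrivMinimiserRowsT3 F (hF ▸ 𝔠) γ hγ hγ1 a₀ a₁ K Ut) →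
                ∃ Ut : (k : ℕ) → GaugeField (F.P K) k (Matrix.specialUnitaryGroup (Fin 2) ℂ) →
                    GaugeField (F.P K) 0 (Matrix.specialUnitaryGroup (Fin 2) ℂ),
                  AlphaInputsT3AC.TrivMinimiserRowsT3 F (hF ▸ 𝔠) γ hγ hγ1 a₀ a₁ K Ut ∧
                    AlphaInputsT3AC.DataRowsT3XsChiSel F (hF ▸ 𝔠) γ hγ hγ1 K Ut) :
    UnitPolyTailL :=
  unitPolyTailL_of_existenceMinimalOrbit_selXsV4DataRows (exBody_allL_of_three hEX₃) hrows

/-- **`UnitPolyTailL` ⟸ {T8 AT `L = 3` ONLY, ⟨stub_selXsV4DataRows⟩}** (T8 at `L ≥ 5` is ✓`thm1In8GlobalMinAt_five`; ✓`thm1In8_allL_of_three`).  CONDITIONAL on both.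
[cite: Balaban1985Variational, Thm 1 (8) p.279 and Prop. 8 p.304; Balaban1985UV3, (67)–(71) p.273] -/
theorem unitPolyTailL_of_thm1In8AtThree_selXsV4DataRows
    (hT8₃ : ∃ a₀ a₁ B₃ : ℝ, 0 < a₀ ∧ 0 < a₁ ∧ 0 < B₃ ∧ Thm1GlobalMinAt 3 a₀ a₁ B₃ ∧ MinimisersIn8At 3 a₀ a₁ B₃)
        (hrows : ∀ L : ℕ, Odd L → 1 < L → ∃ (B₀ A₀ A₁ : ℝ), 0 < A₀ ∧ 0 < A₁ ∧
      ∀ (B a₀ a₁ : ℝ), B₀ ≤ B → 1 ≤ 2 * B → 0 < a₀ → a₀ ≤ A₀ → 0 < a₁ → a₁ ≤ A₁ → B * a₁ ≤ a₀ →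
        (143 * ((((3 + 4 : ℕ) : ℝ)) ^ 2 / 4) ^ 2) * (2 * (B * a₁)) ≤ 1 / 3 →
        2 * (2 * (B * a₁)) ≤ 2 * deltaSU (Fin 2) / (((3 + 4) * L : ℕ) : ℝ) ^ 2 →
        Thm1GlobalMinAt L a₀ a₁ B →
        ∃ (b₁ p₁ : ℝ), ∀ (b₀ p₀ : ℝ), b₁ ≤ b₀ → p₁ ≤ p₀ →
          ∃ 𝔠 : AlphaConsts L (suGroupModel 2).N, 𝔠.b₀ = b₀ ∧ 𝔠.p₀ = p₀ ∧ 𝔠.B₃ = B ∧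
            4 * 𝔠.B₃ * (L : ℝ) ^ 2 * avgWindowFactor L ≤ 𝔠.C68 ∧
            Real.exp (𝔠.p₀ - 1) ≤ 3 * C0 3 * 𝔠.C68 * (𝔠.b₀ * Q0 𝔠.p₀) ∧
            (𝔠.b₀ * Q0 𝔠.p₀) * (2 * (L : ℝ) ^ 2 * avgWindowFactor L) ^ 2 ≤ 3 * C0 3 * 𝔠.C68 * a₁ ^ 2 ∧
            ∀ (F : T3Family) (hF : F.L = L),
              (∀ (γ : ℝ) (hγ : 0 < γ) (hγ1 : γ ≤ (min (hF ▸ 𝔠).gamma0 1) ^ 2) (K : ℕ),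
                AlphaInputsT3AC.SmallFactor71OfRecT3 F (hF ▸ 𝔠) γ hγ hγ1 K) ∧
              ∀ (γ : ℝ) (hγ : 0 < γ) (hγ1 : γ ≤ (min (hF ▸ 𝔠).gamma0 1) ^ 2) (K : ℕ),
                (∃ Ut : (k : ℕ) → GaugeField (F.P K) k (Matrix.specialUnitaryGroup (Fin 2) ℂ) →
                    GaugeField (F.P K) 0 (Matrix.specialUnitaryGroup (Fin 2) ℂ),
                  AlphaInputsT3AC.TrivMinimiserRowsT3 F (hF ▸ 𝔠) γ hγ hγ1 a₀ a₁ K Ut) →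
                ∃ Ut : (k : ℕ) → GaugeField (F.P K) k (Matrix.specialUnitaryGroup (Fin 2) ℂ) →
                    GaugeField (F.P K) 0 (Matrix.specialUnitaryGroup (Fin 2) ℂ),
                  AlphaInputsT3AC.TrivMinimiserRowsT3 F (hF ▸ 𝔠) γ hγ hγ1 a₀ a₁ K Ut ∧
                    AlphaInputsT3AC.DataRowsT3XsChiSel F (hF ▸ 𝔠) γ hγ hγ1 K Ut) :
    UnitPolyTailL :=
  unitPolyTailL_of_T8_selXsV4DataRows (thm1In8_allL_of_three hT8₃) hrows

end Summit.QuantumFields.YangMills.Theorems.CoarseStiffnessTailUnitPolyTailLOfSelXsV4DataRows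

end
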